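import Literature.AlgebraicGeometry.HodgeTheory.BettiKunnethPiecesHardLefschetzReduction
import HarnessLib

/-!
# `HC(T × T')` for two threefolds reduces to FOUR Künneth pieces — `H¹⊗H³`, `H²⊗H²`, `H³⊗H¹ ⊂ H⁴` and `H³⊗H³ ⊂ H⁶`; `HC(S × Z)`, `HC(C × Z)` reduce to the pieces `H¹(S)⊗H^{odd ≤ n}(Z)`, `H²(S)⊗H^{even ≤ n}(Z)`
# (Voisin I Thm. 6.25, Lemma 7.23, Thm. 11.38–11.40, Lemma 11.41, p. 287, Thm. 11.30; Voisin II Prop. 9.20) — unconditionally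

Family `hodge`, lane `lit-hodgefound` (Track 2 foundations library; Layers A2/A4), layer `Literature/AlgebraicGeometry/HodgeTheory`.  THEOREMS ONLY (no definition, no named fact, no instance;
D-0026 net debt `0`).  Sequel of the seat's g29-#2 (`BettiKunnethPiecesHardLefschetzReduction`: `HC(Y × Z)` follows from the algebraicity of the Hodge classes of the Künneth pieces `Hⁱ(Y) ⊗ Hʲ(Z)` with
`1 ≤ i ≤ dim Y`, `1 ≤ j ≤ dim Z`, `i + j ≥ 4`, granted `HC(Y)`, `HC(Z)` — hard Lefschetz on each factor and the cup-closure of divisor classes, both theorems of the tree) applied to the smallest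
interesting shapes: two threefolds (g27-#12 / g28-#1 gave `HC(T ⊗ T')` from eight, then five, `Hom_HS`-conditions by COUNTING Hodge classes; here FOUR membership conditions, or four `Hom`-conditions),
a surface times an `n`-fold, a curve times an `n`-fold.

THE MATHEMATICS.  For threefolds `T`, `T'` the pieces `Hⁱ(T) ⊗ Hʲ(T')` with `1 ≤ i, j ≤ 3` and `i + j = 2c ≥ 4` are `(1,3)`, `(2,2)`, `(3,1)` (`c = 2`) and `(3,3)` (`c = 3`); `HC(T)`, `HC(T')` hold (dimension
`3`: Lefschetz `(1,1)` + hard Lefschetz).  So `HC(T × T')` holds as soon as the Hodge classes of these four pieces map to algebraic classes of `T × T'`; the pieces `H¹ ⊗ H⁵`, `H⁵ ⊗ H¹`, `H² ⊗ H⁴`,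
`H⁴ ⊗ H²`, `H⁰ ⊗ H⁶`, … of `H⁶` and everything in `H⁸`, `H¹⁰` are taken care of by hard Lefschetz (`H⁵ ≅ H¹(−2)`, `H⁴ ≅ H²(−1)`), so the fifth condition `Hom_HS(H¹T, H¹T') = 0` of g28-#1 (which
controlled `H¹ ⊗ H⁵ ≅ (H¹ ⊗ H¹)(−2)`, whose Hodge classes are `(pr₂^*η')² ∪ (divisor classes)`) disappears.  In `Hom` terms (Lemma 11.41 with Tate twists, the lane's
`hodgeClasses_tensor_hodge_eq_bot_iff_subsingleton_hom_tateTwist`): the odd pieces carry NO Hodge class iff `Hom_HS(H¹T, H³T'(1)) = 0`, `Hom_HS(H³T, H¹T'(−1)) = 0` (`⟺ Hom_HS(H¹T', H³T(1)) = 0` by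
transposition), `Hom_HS(H³T, H³T') = 0`, and the Hodge classes of `H²(T) ⊗ H²(T')` are products of divisor classes iff `dim Hom_HS(H²T, H²T') ≤ ρ(T)ρ(T')`.  For a surface `S` and an `n`-fold `Z` the
surviving pieces are `H¹(S) ⊗ Hʲ(Z)` (`j` odd, `3 ≤ j ≤ n`) and `H²(S) ⊗ Hʲ(Z)` (`j` even, `2 ≤ j ≤ n`); for a curve, `H¹(C) ⊗ Hʲ(Z)` (`j` odd, `3 ≤ j ≤ n`).

THE PRINTS.  C. Voisin (2002) [VoisinHodgeI2002] §6.2.3 Thm. 6.25, Rem. 6.27; §7.3.1 Lemma 7.23; §11.3.3 Thm. 11.38, Def. 11.39, Thm. 11.40, Lemma 11.41 (p. 286), p. 287; §11.3.1 Thm. 11.30; §6.1.3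
Cor. 6.13.  C. Voisin (2003) [VoisinHodgeII2003] §9.2.4 Prop. 9.20.  H. Lange (2023) [Lange2023AbelianVarietiesComplex] §2.4.1 Lemma 2.4.1 (transposition for polarized Hodge structures).  P. Deligne
(1971) [DeligneHodgeII1971] 2.1.13–2.1.14.  P. Deligne (2000) [Deligne2000] §1.

THE OBJECTS (all the tree's).  `T T' S C Z : SchemeOver ℂ`; `Hᵏ(X) = BettiUniverse.hodge hHD hX k`; `BettiUniverse.kunnethSummand`, `BettiUniverse.crossMap`; `HodgeStructure.Hom`, `tateTwist`, `cast`; `ofRatClass`,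
`algebraicClasses X p`, `HodgeConjectureFor`; `ρ(X) = dim_ℚ Hdg¹(H²(X))`, `q(X) = h^{1,0}(H¹(X))`, `h^{2,0}(X)`, `b₃(X) = dim_ℚ H³(X;ℚ)`.

WHAT IS PROVED (no hypothesis beyond smooth projectivity and the lane's binder `hHD`).
* §1 TWO THREEFOLDS: **`HC(T ⊗ T')` ⟸ the Hodge classes of the pieces `(1,3)`, `(2,2)`, `(3,1)` of `H⁴` and `(3,3)` of `H⁶` map to algebraic classes** (`BettiUniverse.hodgeConjectureFor_tensor_threefolds_of_kunneth_pieces`);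
  **`HC(T ⊗ T')` ⟸ `Hom_HS(H¹T, H³T'(1)) = 0`, `Hom_HS(H¹T', H³T(1)) = 0`, `Hom_HS(H³T, H³T') = 0`, `dim Hom_HS(H²T, H²T') ≤ ρρ'`** (`…_of_hom_odd_of_finrank_hom_le`); the regular case
  `q = q' = 0`, `h^{2,0}(T) = 0`, `Hom_HS(H³T, H³T') = 0` (`…_of_q_zero_of_h20_zero_of_hom_three`, over g28-#1's `…_of_q_zero_of_hom_of_hardLefschetz`) and **`HC(T ⊗ T')` for `q(T) = b₃(T) = 0` and any `T'` with `dim Hom_HS(H²T, H²T') ≤ ρρ'`** (`…_of_q_zero_of_b3_zero_of_finrank_hom_le`).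
* §2 **`HC(S ⊗ Z)` ⟸ `HC(Z)` and the pieces `H¹(S) ⊗ Hʲ(Z)` (`3 ≤ j ≤ n` odd), `H²(S) ⊗ Hʲ(Z)` (`2 ≤ j ≤ n` even)** (`BettiUniverse.hodgeConjectureFor_surface_tensor_of_kunneth_pieces`); **`HC(C ⊗ Z)` ⟸ `HC(Z)` and the
  pieces `H¹(C) ⊗ Hʲ(Z)` (`3 ≤ j ≤ n` odd)** (`BettiUniverse.hodgeConjectureFor_curve_tensor_of_kunneth_pieces`).

DEVIATIONS / SCOPE.  Membership («the Hodge classes of the piece map to algebraic classes») is weaker than the counting hypotheses of g27/g28 and is what correspondences deliver; nothing is claimed about the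
four pieces themselves (abelian sub-Hodge structures of `H³`, morphisms between transcendental parts of `H²`, `End_HS(H³)`).

## References
* [VoisinHodgeI2002] C. Voisin, *Hodge Theory and Complex Algebraic Geometry I* (2002) — §6.2.3 Thm. 6.25, Rem. 6.27; §7.3.1 Lemma 7.23; §11.3.3 Thm. 11.38, Thm. 11.40, Lemma 11.41, p. 287; §11.3.1 Thm. 11.30;
  §6.1.3 Cor. 6.13.
* [VoisinHodgeII2003] C. Voisin, *Hodge Theory and Complex Algebraic Geometry II* (2003) — §9.2.4 Prop. 9.20.
* [Lange2023AbelianVarietiesComplex] H. Lange, *Abelian Varieties over the Complex Numbers* (2023) — §2.4.1 Lemma 2.4.1.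
* [DeligneHodgeII1971] P. Deligne, *Théorie de Hodge II* (1971) — 2.1.13–2.1.14.
* [Deligne2000] P. Deligne, *The Hodge conjecture* (Clay, 2000) — §1.

## Provenance
Lane `lit-hodgefound` (Hodge path, Track 2), prover seat `lit-hodgefound-p29` (generation 29), self-proposed row g29-#3 (the g29-#2 assembly on threefold, surface and curve factors).
-/

noncomputable section

open scoped TensorProduct
open CategoryTheory MonoidalCategory CartesianMonoidalCategory Module Finset
open Literature.AlgebraicTopology.SingularHomology
open Literature.Geometry.Kaehler

namespace Literature.AlgebraicGeometry.HodgeTheory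

open Literature.AlgebraicGeometry.Motives
open Literature.AlgebraicGeometry.Motives.HodgeStructure

variable {m n d : ℕ} {X Y Z : SchemeOver ℂ}

/-! ### §1 Two threefolds: four pieces -/

section ThreefoldsFourPieces

variable [HodgeTensorFacts.{0, 0}] {T T' S C : SchemeOver ℂ}

/-- **`HC(T × T')` for two smooth projective threefolds as soon as the Hodge classes of the FOUR Künneth pieces `H¹(T) ⊗ H³(T')`, `H²(T) ⊗ H²(T')`, `H³(T) ⊗ H¹(T')` of `H⁴(T × T')` and `H³(T) ⊗ H³(T')`
of `H⁶(T × T')` map to algebraic classes** — UNCONDITIONALLY: by the hard-Lefschetz reduction (g29-#2) only the pieces `Hⁱ ⊗ Hʲ` with `1 ≤ i, j ≤ 3`, `i + j ∈ {4, 6}` matter (`HC(T)`, `HC(T')` hold in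
dimension `3`; total degree `2` is Lefschetz `(1,1)`; e.g. `H² ⊗ H⁴ ⊂ H⁶` reduces to `H² ⊗ H² ⊂ H⁴`, `H¹ ⊗ H⁵` to `H¹ ⊗ H¹`). [cite: VoisinHodgeI2002, §6.2.3 Thm. 6.25, Rem. 6.27, §7.3.1 Lemma 7.23, §11.3.3 Thm. 11.38–11.40,
Lemma 11.41 and p. 287, §11.3.1 Thm. 11.30] [cite: Deligne2000, §1] [cite: VoisinHodgeII2003, §9.2.4 Prop. 9.20] -/
theorem BettiUniverse.hodgeConjectureFor_tensor_threefolds_of_kunneth_pieces (hHD : exists_isReal_hodgeModel) (hT : IsSmoothProjective 3 T) (hT' : IsSmoothProjective 3 T')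
    (hTT' : IsSmoothProjective 6 (T ⊗ T'))
    (h13 : ∀ t ∈ (BettiUniverse.kunnethSummand hHD hT hT' (2 * 2) ⟨(1, 3), HasAntidiagonal.mem_antidiagonal.2 rfl⟩).hodgeClasses 2,
      ofRatClass (ComplexPoints (T ⊗ T')) (2 * 2) (BettiUniverse.crossMap T T' (show 1 + 3 = 2 * 2 by norm_num) t) ∈ algebraicClasses (T ⊗ T') 2)
    (h22 : ∀ t ∈ (BettiUniverse.kunnethSummand hHD hT hT' (2 * 2) ⟨(2, 2), HasAntidiagonal.mem_antidiagonal.2 rfl⟩).hodgeClasses 2,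
      ofRatClass (ComplexPoints (T ⊗ T')) (2 * 2) (BettiUniverse.crossMap T T' (show 2 + 2 = 2 * 2 by norm_num) t) ∈ algebraicClasses (T ⊗ T') 2)
    (h31 : ∀ t ∈ (BettiUniverse.kunnethSummand hHD hT hT' (2 * 2) ⟨(3, 1), HasAntidiagonal.mem_antidiagonal.2 rfl⟩).hodgeClasses 2,
      ofRatClass (ComplexPoints (T ⊗ T')) (2 * 2) (BettiUniverse.crossMap T T' (show 3 + 1 = 2 * 2 by norm_num) t) ∈ algebraicClasses (T ⊗ T') 2)
    (h33 : ∀ t ∈ (BettiUniverse.kunnethSummand hHD hT hT' (2 * 3) ⟨(3, 3), HasAntidiagonal.mem_antidiagonal.2 rfl⟩).hodgeClasses 3,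
      ofRatClass (ComplexPoints (T ⊗ T')) (2 * 3) (BettiUniverse.crossMap T T' (show 3 + 3 = 2 * 3 by norm_num) t) ∈ algebraicClasses (T ⊗ T') 3) :
    HodgeConjectureFor 6 (T ⊗ T') := by
  refine BettiUniverse.hodgeConjectureFor_tensor_of_kunneth_pieces_pos_le hHD hT hT' hTT' (hodgeConjectureFor_of_dim_le_three_holds le_rfl hT)
    (hodgeConjectureFor_of_dim_le_three_holds le_rfl hT') fun c i j hij hi1 hi hj1 hj hc2 t ht ↦ ?_
  have hcases : (c = 2 ∧ (i = 1 ∧ j = 3 ∨ i = 2 ∧ j = 2 ∨ i = 3 ∧ j = 1)) ∨ (c = 3 ∧ i = 3 ∧ j = 3) := by omega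
  rcases hcases with ⟨rfl, ⟨rfl, rfl⟩ | ⟨rfl, rfl⟩ | ⟨rfl, rfl⟩⟩ | ⟨rfl, rfl, rfl⟩
  · exact h13 t ht
  · exact h22 t ht
  · exact h31 t ht
  · exact h33 t ht

/-- **`HC(T × T')` for two smooth projective threefolds with `Hom_HS(H¹(T), H³(T')(1)) = 0`, `Hom_HS(H¹(T'), H³(T)(1)) = 0`, `Hom_HS(H³(T), H³(T')) = 0` and `dim_ℚ Hom_HS(H²(T), H²(T')) ≤ ρ(T)ρ(T')`** —
FOUR conditions (the seat's g28-#1 `…_of_hom_of_hardLefschetz` had five: `Hom_HS(H¹T, H¹T') = 0` is no longer needed — the pieces `H¹⊗H¹ ⊂ H²`, `H¹⊗H⁵`, `H⁵⊗H¹ ⊂ H⁶` are divisor-type), unconditionally: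
the three odd pieces carry no Hodge class at all (Lemma 11.41 with twists; the transposition `Hom_HS(H³T, H¹T'(−1)) ≅ Hom_HS(H¹T', H³T(1))`) and the Hodge classes of `H²(T) ⊗ H²(T')` are spanned by the `ρρ'`
products of divisor classes. [cite: VoisinHodgeI2002, §11.3.3 Lemma 11.41, p. 287, Thm. 11.30 and §6.2.3 Thm. 6.25] [cite: Lange2023AbelianVarietiesComplex, §2.4.1 Lemma 2.4.1] [cite: Deligne2000, §1] [cite: VoisinHodgeII2003, §9.2.4 Prop. 9.20] -/
theorem BettiUniverse.hodgeConjectureFor_tensor_threefolds_of_hom_odd_of_finrank_hom_le (hHD : exists_isReal_hodgeModel) (hT : IsSmoothProjective 3 T) (hT' : IsSmoothProjective 3 T')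
    (hTT' : IsSmoothProjective 6 (T ⊗ T'))
    (h13 : Subsingleton (HodgeStructure.Hom (BettiUniverse.hodge hHD hT 1) (((BettiUniverse.hodge hHD hT' 3).tateTwist 1).cast (by norm_num))))
    (h13' : Subsingleton (HodgeStructure.Hom (BettiUniverse.hodge hHD hT' 1) (((BettiUniverse.hodge hHD hT 3).tateTwist 1).cast (by norm_num))))
    (h33 : Subsingleton (HodgeStructure.Hom (BettiUniverse.hodge hHD hT 3) (BettiUniverse.hodge hHD hT' 3)))
    (h22 : Module.finrank ℚ (HodgeStructure.Hom (BettiUniverse.hodge hHD hT 2) (BettiUniverse.hodge hHD hT' 2)) ≤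
      Module.finrank ℚ ↥((BettiUniverse.hodge hHD hT 2).hodgeClasses 1) * Module.finrank ℚ ↥((BettiUniverse.hodge hHD hT' 2).hodgeClasses 1)) :
    HodgeConjectureFor 6 (T ⊗ T') := by
  haveI : HodgeTensorFacts.{0, 0} := ‹_›
  haveI := BettiUniverse.finite hT 1
  haveI := BettiUniverse.finite hT 2
  haveI := BettiUniverse.finite hT 3
  haveI := BettiUniverse.finite hT' 1
  haveI := BettiUniverse.finite hT' 2
  haveI := BettiUniverse.finite hT' 3
  refine BettiUniverse.hodgeConjectureFor_tensor_threefolds_of_kunneth_pieces hHD hT hT' hTT' (fun t ht ↦ ?_) (fun t ht ↦ ?_) (fun t ht ↦ ?_) (fun t ht ↦ ?_)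
  · -- `H¹(T) ⊗ H³(T')` has no Hodge class
    have hbot := (BettiUniverse.hodgeClasses_tensor_hodge_eq_bot_iff_subsingleton_hom_tateTwist hHD hT hT' 1 3 (s := 1) (by norm_num)).2 h13
    change t ∈ ((BettiUniverse.hodge hHD hT 1).tensor (BettiUniverse.hodge hHD hT' 3)).hodgeClasses 2 at ht
    rw [show (2 : ℤ) = ((1 : ℕ) : ℤ) + 1 by norm_num, hbot, Submodule.mem_bot] at ht
    rw [ht, map_zero, map_zero]
    exact Submodule.zero_mem _
  · -- `H²(T) ⊗ H²(T')` is spanned by products of divisor classes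
    set P : Submodule ℚ (bettiCohomology T 2 ⊗[ℚ] bettiCohomology T' 2) :=
      LinearMap.range (TensorProduct.mapIncl ((BettiUniverse.hodge hHD hT 2).hodgeClasses 1) ((BettiUniverse.hodge hHD hT' 2).hodgeClasses 1)) with hP
    have hPle : P ≤ ((BettiUniverse.hodge hHD hT 2).tensor (BettiUniverse.hodge hHD hT' 2)).hodgeClasses (1 + 1) := by
      rw [hP, TensorProduct.range_mapIncl, Submodule.map₂_le]
      exact fun y hy z hz ↦ HodgeStructure.tmul_mem_hodgeClasses_tensor _ _ hy hz
    haveI : Module.Free ℚ ↥((BettiUniverse.hodge hHD hT 2).hodgeClasses 1) := Module.Free.of_divisionRing ℚ _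
    haveI : Module.Free ℚ ↥((BettiUniverse.hodge hHD hT' 2).hodgeClasses 1) := Module.Free.of_divisionRing ℚ _
    have hPrank : Module.finrank ℚ ↥P = Module.finrank ℚ ↥((BettiUniverse.hodge hHD hT 2).hodgeClasses 1) * Module.finrank ℚ ↥((BettiUniverse.hodge hHD hT' 2).hodgeClasses 1) := by
      rw [hP, LinearMap.finrank_range_of_inj (Module.Flat.tensorProduct_mapIncl_injective_of_right _ _), Module.finrank_tensorProduct]
    have hHrank : Module.finrank ℚ ↥(((BettiUniverse.hodge hHD hT 2).tensor (BettiUniverse.hodge hHD hT' 2)).hodgeClasses (1 + 1)) =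
        Module.finrank ℚ (HodgeStructure.Hom (BettiUniverse.hodge hHD hT 2) (BettiUniverse.hodge hHD hT' 2)) := by
      rw [show (1 : ℤ) + 1 = ((2 : ℕ) : ℤ) by norm_num]
      exact BettiUniverse.finrank_hodgeClasses_tensor_hodge_eq_finrank_hom hHD hT hT' 2
    have hPeq : P = ((BettiUniverse.hodge hHD hT 2).tensor (BettiUniverse.hodge hHD hT' 2)).hodgeClasses (1 + 1) :=
      Submodule.eq_of_le_of_finrank_le hPle (by rw [hHrank, hPrank]; exact h22)
    have ht' : t ∈ P := by
      rw [hPeq, show (1 : ℤ) + 1 = 2 by norm_num]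
      exact ht
    rw [hP] at ht'
    obtain ⟨w, rfl⟩ := ht'
    clear ht
    induction w using TensorProduct.induction_on with
    | zero => rw [map_zero, map_zero, map_zero]; exact Submodule.zero_mem _
    | tmul p q =>
      rw [TensorProduct.mapIncl, TensorProduct.map_tmul, Submodule.subtype_apply, Submodule.subtype_apply]
      have hpq := BettiUniverse.ofRatClass_crossMap_tmul_mem_algebraicClasses hT hT' ((BettiUniverse.mem_hodgeClasses_hodge_two_iff_ofRatClass_mem_algebraicClasses_one hHD hT _).1 p.2)
        ((BettiUniverse.mem_hodgeClasses_hodge_two_iff_ofRatClass_mem_algebraicClasses_one hHD hT' _).1 q.2)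
      exact hpq
    | add x y hx hy => rw [map_add, map_add, map_add]; exact Submodule.add_mem _ hx hy
  · -- `H³(T) ⊗ H¹(T')` has no Hodge class: `Hom_HS(H³T, H¹T'(−1)) ≅ Hom_HS(H¹T', H³T(1)) = 0`
    have hz : Module.finrank ℚ ↥(((BettiUniverse.hodge hHD hT 3).tensor (BettiUniverse.hodge hHD hT' 1)).hodgeClasses (((3 : ℕ) : ℤ) + (-1))) = 0 := by
      rw [BettiUniverse.finrank_hodgeClasses_tensor_hodge_eq_finrank_hom_tateTwist hHD hT hT' 3 1 (s := -1) (by norm_num),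
        BettiUniverse.finrank_hom_hodge_tateTwist_swap hHD hT hT' 3 (s := -1) (s' := 1) (by norm_num) (by norm_num) (by norm_num)]
      exact Module.finrank_zero_of_subsingleton
    have hbot := Submodule.finrank_eq_zero.1 hz
    change t ∈ ((BettiUniverse.hodge hHD hT 3).tensor (BettiUniverse.hodge hHD hT' 1)).hodgeClasses 2 at ht
    rw [show (2 : ℤ) = ((3 : ℕ) : ℤ) + (-1) by norm_num, hbot, Submodule.mem_bot] at ht
    rw [ht, map_zero, map_zero]
    exact Submodule.zero_mem _
  · -- `H³(T) ⊗ H³(T')` has no Hodge class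
    have hz : Module.finrank ℚ ↥(((BettiUniverse.hodge hHD hT 3).tensor (BettiUniverse.hodge hHD hT' 3)).hodgeClasses ((3 : ℕ) : ℤ)) = 0 := by
      rw [BettiUniverse.finrank_hodgeClasses_tensor_hodge_eq_finrank_hom hHD hT hT' 3]
      exact Module.finrank_zero_of_subsingleton
    have hbot := Submodule.finrank_eq_zero.1 hz
    change t ∈ ((BettiUniverse.hodge hHD hT 3).tensor (BettiUniverse.hodge hHD hT' 3)).hodgeClasses 3 at ht
    rw [show (3 : ℤ) = ((3 : ℕ) : ℤ) by norm_num, hbot, Submodule.mem_bot] at ht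
    rw [ht, map_zero, map_zero]
    exact Submodule.zero_mem _

/-- **`HC(T × T')` for two threefolds when `q(T) = q(T') = 0`, `Hom_HS(H³(T), H³(T')) = 0` and `h^{2,0}(T) = 0`** (then `dim Hom_HS(H²T, H²T') = ρ(T)ρ(T')` automatically): e.g. `T` a regular threefold
with `h^{2,0} = 0` (Fano, Calabi–Yau, …) against any regular `T'` with no morphism `H³(T) → H³(T')` (corollary of the seat's g28-#1 `…_of_q_zero_of_hom_of_hardLefschetz`). [cite: VoisinHodgeI2002, §11.3.3 Lemma 11.41, p. 287, Thm. 11.30, §6.1.3 Cor. 6.13 and §6.2.3 Thm. 6.25] [cite: DeligneHodgeII1971, 2.1.13] [cite: Deligne2000, §1] -/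
theorem BettiUniverse.hodgeConjectureFor_tensor_threefolds_of_q_zero_of_h20_zero_of_hom_three (hHD : exists_isReal_hodgeModel) (hT : IsSmoothProjective 3 T) (hT' : IsSmoothProjective 3 T')
    (hTT' : IsSmoothProjective 6 (T ⊗ T')) (hq : (BettiUniverse.hodge hHD hT 1).hodgeNumber 1 0 = 0) (hq' : (BettiUniverse.hodge hHD hT' 1).hodgeNumber 1 0 = 0)
    (h20 : (BettiUniverse.hodge hHD hT 2).hodgeNumber 2 0 = 0) (h33 : Subsingleton (HodgeStructure.Hom (BettiUniverse.hodge hHD hT 3) (BettiUniverse.hodge hHD hT' 3))) :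
    HodgeConjectureFor 6 (T ⊗ T') := by
  haveI : HodgeTensorFacts.{0, 0} := ‹_›
  haveI := BettiUniverse.finite hT 2
  haveI := BettiUniverse.finite hT' 2
  refine BettiUniverse.hodgeConjectureFor_tensor_threefolds_of_q_zero_of_hom_of_hardLefschetz hHD hT hT' hTT' hq hq' h33 (le_of_eq ?_)
  have htop : (BettiUniverse.hodge hHD hT 2).hodgeClasses 1 = ⊤ := (BettiUniverse.hodgeClasses_hodge_two_eq_top_iff hHD hT).2 h20
  have e := BettiUniverse.finrank_hodgeClasses_tensor_hodge_of_hodgeClasses_eq_top_left hHD hT hT' (i := 2) (a := 1) (by norm_num) htop 2 1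
  rw [show (1 : ℤ) + 1 = ((2 : ℕ) : ℤ) by norm_num] at e
  rw [← BettiUniverse.finrank_hodgeClasses_tensor_hodge_eq_finrank_hom hHD hT hT' 2, e, htop, finrank_top]

/-- **`HC(T × T')` for a threefold `T` with `q(T) = 0`, `b₃(T) = 0` and ANY threefold `T'` with `dim Hom_HS(H²T, H²T') ≤ ρ(T)ρ(T')`** (`H¹(T) = 0` kills `Hom_HS(H¹T, H³T'(1))`, `H³(T) = 0` kills
`Hom_HS(H¹T', H³T(1))` and `Hom_HS(H³T, H³T')`); with `h^{2,0}(T) = 0` as well `T` is of Hodge–Tate type and the last condition is void (the lane's `BettiHodgeTateTypeHodgeConjecture`).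
[cite: VoisinHodgeI2002, §11.3.3 Lemma 11.41, p. 287, Thm. 11.30 and §6.2.3 Thm. 6.25] [cite: Deligne2000, §1] -/
theorem BettiUniverse.hodgeConjectureFor_tensor_threefolds_of_q_zero_of_b3_zero_of_finrank_hom_le (hHD : exists_isReal_hodgeModel) (hT : IsSmoothProjective 3 T) (hT' : IsSmoothProjective 3 T')
    (hTT' : IsSmoothProjective 6 (T ⊗ T')) (hq : (BettiUniverse.hodge hHD hT 1).hodgeNumber 1 0 = 0) (hb3 : Module.finrank ℚ (bettiCohomology T 3) = 0)
    (h22 : Module.finrank ℚ (HodgeStructure.Hom (BettiUniverse.hodge hHD hT 2) (BettiUniverse.hodge hHD hT' 2)) ≤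
      Module.finrank ℚ ↥((BettiUniverse.hodge hHD hT 2).hodgeClasses 1) * Module.finrank ℚ ↥((BettiUniverse.hodge hHD hT' 2).hodgeClasses 1)) :
    HodgeConjectureFor 6 (T ⊗ T') := by
  haveI := BettiUniverse.finite hT 1
  haveI := BettiUniverse.finite hT 3
  haveI : Subsingleton (bettiCohomology T 1) := Module.finrank_zero_iff.1 ((BettiUniverse.finrank_bettiCohomology_one_eq_zero_iff hHD hT).2 hq)
  haveI : Subsingleton (bettiCohomology T 3) := Module.finrank_zero_iff.1 hb3
  exact BettiUniverse.hodgeConjectureFor_tensor_threefolds_of_hom_odd_of_finrank_hom_le hHD hT hT' hTT' HodgeStructure.Hom.toLinearMap_injective.subsingleton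
    HodgeStructure.Hom.toLinearMap_injective.subsingleton HodgeStructure.Hom.toLinearMap_injective.subsingleton h22

end ThreefoldsFourPieces

/-! ### §2 Surfaces and curves against an `n`-fold -/

section SurfaceTimesNfold

variable [HodgeTensorFacts.{0, 0}] {S C T : SchemeOver ℂ}

/-- **`HC(S × Z)` for a smooth projective surface `S` and an `n`-fold `Z` satisfying `HC(Z)`, as soon as the Hodge classes of the pieces `H¹(S) ⊗ Hʲ(Z)` (`j` odd, `3 ≤ j ≤ n`) and `H²(S) ⊗ Hʲ(Z)`
(`j` even, `2 ≤ j ≤ n`) map to algebraic classes** — unconditionally (`HC(S)` holds; the pieces with `j > n` reduce by hard Lefschetz on `Z`, those with `j ≤ 1`/total degree `2` are divisor-type, and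
`H⁰(S) ⊗ H^{2c}(Z)` is governed by `HC(Z)`).  For `n = 3` these are the two pieces `H¹(S)⊗H³(T)`, `H²(S)⊗H²(T)` of g29-#1. [cite: VoisinHodgeI2002, §6.2.3 Thm. 6.25, §11.3.3 Thm. 11.38–11.40, Lemma 11.41 and p. 287, §11.3.1 Thm. 11.30]
[cite: Deligne2000, §1] [cite: VoisinHodgeII2003, §9.2.4 Prop. 9.20] -/
theorem BettiUniverse.hodgeConjectureFor_surface_tensor_of_kunneth_pieces (hHD : exists_isReal_hodgeModel) (hS : IsSmoothProjective 2 S) (hZ : IsSmoothProjective n Z) (hSZ : IsSmoothProjective d (S ⊗ Z))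
    (hHCZ : HodgeConjectureFor n Z)
    (h1 : ∀ (c j : ℕ) (hj : 1 + j = 2 * c), 3 ≤ j → j ≤ n →
      ∀ t ∈ (BettiUniverse.kunnethSummand hHD hS hZ (2 * c) ⟨(1, j), HasAntidiagonal.mem_antidiagonal.2 hj⟩).hodgeClasses c,
        ofRatClass (ComplexPoints (S ⊗ Z)) (2 * c) (BettiUniverse.crossMap S Z hj t) ∈ algebraicClasses (S ⊗ Z) c)
    (h2 : ∀ (c j : ℕ) (hj : 2 + j = 2 * c), 2 ≤ j → j ≤ n →
      ∀ t ∈ (BettiUniverse.kunnethSummand hHD hS hZ (2 * c) ⟨(2, j), HasAntidiagonal.mem_antidiagonal.2 hj⟩).hodgeClasses c,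
        ofRatClass (ComplexPoints (S ⊗ Z)) (2 * c) (BettiUniverse.crossMap S Z hj t) ∈ algebraicClasses (S ⊗ Z) c) :
    HodgeConjectureFor d (S ⊗ Z) := by
  refine BettiUniverse.hodgeConjectureFor_tensor_of_kunneth_pieces_pos_le hHD hS hZ hSZ (hodgeConjectureFor_of_dim_le_three_holds (by norm_num) hS) hHCZ
    fun c i j hij hi1 hi hj1 hj hc2 t ht ↦ ?_
  obtain rfl | rfl : i = 1 ∨ i = 2 := by omega
  · exact h1 c j hij (by omega) hj t ht
  · exact h2 c j hij (by omega) hj t ht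

/-- **`HC(C × Z)` for a smooth projective curve `C` and an `n`-fold `Z` satisfying `HC(Z)`, as soon as the Hodge classes of the pieces `H¹(C) ⊗ Hʲ(Z)` (`j` odd, `3 ≤ j ≤ n`) map to algebraic
classes** — the membership form of the lane's curve criteria (`BettiHodgeClassesProductWithCurve(HodgeMorphisms)`: `Hom_HS(H¹(C), H^{2c−1}(Z)(c−1))`-classes); for `n ≤ 2` the condition is void.
[cite: VoisinHodgeI2002, §6.2.3 Thm. 6.25, §11.3.3 Thm. 11.38–11.40, Lemma 11.41 and p. 287, §11.3.1 Thm. 11.30] [cite: Deligne2000, §1] -/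
theorem BettiUniverse.hodgeConjectureFor_curve_tensor_of_kunneth_pieces (hHD : exists_isReal_hodgeModel) (hC : IsSmoothProjective 1 C) (hZ : IsSmoothProjective n Z) (hCZ : IsSmoothProjective d (C ⊗ Z))
    (hHCZ : HodgeConjectureFor n Z)
    (h1 : ∀ (c j : ℕ) (hj : 1 + j = 2 * c), 3 ≤ j → j ≤ n →
      ∀ t ∈ (BettiUniverse.kunnethSummand hHD hC hZ (2 * c) ⟨(1, j), HasAntidiagonal.mem_antidiagonal.2 hj⟩).hodgeClasses c,
        ofRatClass (ComplexPoints (C ⊗ Z)) (2 * c) (BettiUniverse.crossMap C Z hj t) ∈ algebraicClasses (C ⊗ Z) c) :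
    HodgeConjectureFor d (C ⊗ Z) := by
  refine BettiUniverse.hodgeConjectureFor_tensor_of_kunneth_pieces_pos_le hHD hC hZ hCZ (hodgeConjectureFor_of_dim_le_three_holds (by norm_num) hC) hHCZ
    fun c i j hij hi1 hi hj1 hj hc2 t ht ↦ ?_
  obtain rfl : i = 1 := by omega
  exact h1 c j hij (by omega) hj t ht

end SurfaceTimesNfold

end Literature.AlgebraicGeometry.HodgeTheory

end
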